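import Literature.AnabelianGeometry.EtaleTheta.Discharge.Sec5ModelCaseSlim
import Literature.AnabelianGeometry.EtaleTheta.Discharge.Sec5Thm57Constants

/-!
# [EtTh] §5 for a MODEL tempered Frobenioid, IV: Theorem 5.7 / 5.10 (ii)(iii) with the rigidity input cut down to its torsion half (pp. 329–335 / PDF pp. 103–109)

Mochizuki, *The étale theta function …*, Publ. RIMS **45** (2009)
[cite: MochizukiEtTh2009, Thm 5.7 p.330 (PDF p.104); Thm 5.10 (ii)(iii) p.333–335 (PDF pp.107–109)].  Seat
abc-iut-L2-d4 (sequel to `Sec5ModelCase{,Base,Slim}.lean` and `Sec5Thm57Constants.lean`); PROOF-ONLY.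

For §5 data over a MODEL tempered Frobenioid ([EtTh] Def. 3.6 (ii): `𝔉.pre = PreFrobenioidData.ofModel Φ B DivB`,
under abc-iut-L1's `ModelFrobenioid.Hypotheses` with a base of FSM-type) every [FrdI] category-theoretic input of
the Thm. 5.7 / 5.10 chain is a theorem of layer L1 (`Sec5ModelCase*`).  The remaining rigidity input there was
`hζ` — print's conclusion of Thm. 5.7 read for the unit: "`u^N` is a `2l`-th root of unity of `K`", i.e. BOTH halves
of `u ∈ μ_{2l·N}(B_N) ∩ (O_K^×)^{1/N}`.  With `Sec5Thm57Constants.discrepancy_mem_OKxRootN` the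
`(O_K^×)^{1/N}`-half is a THEOREM (from abc-iut-L2-t4's §5 `Facts` — Prop. 4.3 (iii), Lemma 5.8 by name — plus the
factorisation binder `hfac` of the Galois action on constants through `G_K`, GAP G-L2d4-1), so for the model
(`thm510_ii_iii_of_model_torsion`, `…_slim_torsion`, `rootTransport_of_model_slim_torsion`) the ONLY rigidity input
left is the torsion half `htor : u^{2l·N} = 1` ("up to possible multiplication by a `2l`-th root of unity",
Thm. 5.7 p.330; Rmk. 5.7.1: the part "substantially stronger" than preservation up to a constant).
HONEST FRAMING: kernel-checked implications; nothing asserts that the §5 data exist for an actual curve; typed ≠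
discharged; no side is taken on anything downstream. -/

set_option backward.isDefEq.respectTransparency false

namespace Literature.AnabelianGeometry.EtaleTheta

open CategoryTheory Opposite
open Literature.AlgebraicGeometry.Frobenioids

universe w v u

namespace ThetaFrobenioid

variable {D : Type u} [Category.{v} D] {Φ B : Dᵒᵖ ⥤ CommMonCat.{w}} {DivB : B ⟶ monoidGp Φ}
  {𝔉 : ThetaFrobenioid.{w} (ModelFrobenioid Φ B DivB) D}

section Torsion

variable (Ψ : ModelFrobenioid Φ B DivB ≌ ModelFrobenioid Φ B DivB)
  (α : Ψ.functor.obj 𝔉.AN ≅ 𝔉.AN) (β : Ψ.functor.obj 𝔉.BN ≅ 𝔉.BN)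

/-- **[EtTh] Theorem 5.7 at the `N`-th root for a GIVEN `e`, model case, no [FrdI] binder, torsion clause only**:
for §5 data over a model tempered Frobenioid over a slim base of FSM-type (`Φ` non-dilating, `C` not of group-like
type — [EtTh] Thm. 3.7 (i)(ii), Rmk. 3.7.2), from abc-iut-L2-t4's §5 `Facts` fields (`SgpCapSpec`, `SgpCupSpec`,
Prop. 4.3 (iii), Lemma 5.8), a faithful 1-compatible `Ψ^bs` obtained FROM LAYER L1
(`exists_compatBase_of_model_slim`), Prop. 5.3 (vi) at `A_N` for `e`, the Thm. 4.4 (iv)/Prop. 2.4 data (`θ`,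
`hstrv`, `hYdd`), the factorisation `hfac` and `htor`: some `D_c, D_p` with `RootTransportWith Ψ α β e D_c D_p`.
[cite: MochizukiEtTh2009, Thm 5.7 p.329–330 (PDF pp.103–104); Def 3.6 p.303 (PDF p.77)] -/
theorem exists_rootTransportWith_of_model_slim_torsion (h𝔉 : 𝔉.pre = PreFrobenioidData.ofModel Φ B DivB)
    (h : ModelFrobenioid.Hypotheses Φ B) (hD : IsOfFSMType D) (hslim : IsSlim D) (hnd : IsNonDilatingOn Φ)
    (hN : ∃ A : ModelFrobenioid Φ B DivB, ¬ (PreFrobenioidData.ofModel Φ B DivB).IsGroupLikeObj A)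
    (hcap : 𝔉.SgpCapSpec) (hcup : 𝔉.SgpCupSpec) (hdiff : 𝔉.BiKummerDifferenceMem)
    (h58 : 𝔉.ConstantsActByCyclotome)
    (hfac : ∀ y ∈ 𝔉.imPiY, ∃ h ∈ 𝔉.HB, ∀ u ∈ 𝔉.units 𝔉.BN,
      𝔉.sgpCap y * u * (𝔉.sgpCap y)⁻¹ = 𝔉.sgpCap h * u * (𝔉.sgpCap h)⁻¹)
    (e : 𝔉.AN ≅ 𝔉.AN)
    (hdivcap : 𝔉.pre.div (α.inv ≫ Ψ.functor.map 𝔉.sCap ≫ β.hom) = 𝔉.pre.div (e.hom ≫ 𝔉.sCap))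
    (hdivcup : 𝔉.pre.div (α.inv ≫ Ψ.functor.map 𝔉.sCup ≫ β.hom) = 𝔉.pre.div (e.hom ≫ 𝔉.sCup))
    (θ : Aut (𝔉.base.obj 𝔉.BN) ≃* Aut (𝔉.base.obj 𝔉.BN))
    (hstrv : ∀ g : Aut (𝔉.base.obj 𝔉.BN),
      α.inv ≫ Ψ.functor.map (𝔉.strv (𝔉.autBaseIsoAB.symm g)).hom ≫ α.hom ≫ e.hom =
        e.hom ≫ (𝔉.strv (𝔉.autBaseIsoAB.symm (θ g))).hom)
    (hYdd : 𝔉.HB.map θ.toMonoidHom = 𝔉.HB)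
    (htor : ∀ Dc Dp : Aut 𝔉.BN,
      α.inv ≫ Ψ.functor.map 𝔉.sCap ≫ β.hom = e.hom ≫ 𝔉.sCap ≫ Dc.hom →
      α.inv ≫ Ψ.functor.map 𝔉.sCup ≫ β.hom = e.hom ≫ 𝔉.sCup ≫ Dp.hom →
      Dc⁻¹ * Dp ∈ 𝔉.units 𝔉.BN → (Dc⁻¹ * Dp) ^ (2 * 𝔉.l * 𝔉.N) = 1) :
    ∃ Dc Dp : Aut 𝔉.BN, 𝔉.RootTransportWith Ψ α β e Dc Dp ∧ Dc⁻¹ * Dp ∈ 𝔉.units 𝔉.BN := by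
  obtain ⟨Ψbs, hΨbs, ⟨eΨ⟩⟩ := exists_compatBase_of_model_slim Ψ h𝔉 h hD hslim hnd hN
  haveI := hΨbs
  exact exists_rootTransportWith_of_torsion Ψ α β e θ (epi_of_model h)
    (isOfIsotropicType_of_model h𝔉 h.isGroupLike_rat) (iiid_of_model h𝔉 h.isGroupLike_rat)
    (preservesPreSteps_of_model h𝔉 h hD Ψ) (baseEquivalent_map_of_model h𝔉 h hD hslim hnd hN Ψ) hcap hcup hdiff
    h58 hfac (units_map_psiAut Ψ β Ψbs eΨ) hdivcap hdivcup hstrv hYdd htor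

/-- **[EtTh] Theorem 5.7 at the `N`-th root (`RootTransport Ψ α β`), model case, no [FrdI] binder, torsion clause
only** — `Sec5ModelCaseSlim.rootTransport_of_model_slim` with `hrig` replaced by the §5 `Facts` fields, `hfac`, the
Thm. 4.4 (iv)/Prop. 2.4 data for the divisor-matching `e` (`hdivθ`) and `htor`.
[cite: MochizukiEtTh2009, Thm 5.7 p.329–330 (PDF pp.103–104)] -/
theorem rootTransport_of_model_slim_torsion (h𝔉 : 𝔉.pre = PreFrobenioidData.ofModel Φ B DivB)
    (h : ModelFrobenioid.Hypotheses Φ B) (hD : IsOfFSMType D) (hslim : IsSlim D) (hnd : IsNonDilatingOn Φ)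
    (hN : ∃ A : ModelFrobenioid Φ B DivB, ¬ (PreFrobenioidData.ofModel Φ B DivB).IsGroupLikeObj A)
    (hcap : 𝔉.SgpCapSpec) (hcup : 𝔉.SgpCupSpec) (hdiff : 𝔉.BiKummerDifferenceMem)
    (h58 : 𝔉.ConstantsActByCyclotome)
    (hfac : ∀ y ∈ 𝔉.imPiY, ∃ h ∈ 𝔉.HB, ∀ u ∈ 𝔉.units 𝔉.BN,
      𝔉.sgpCap y * u * (𝔉.sgpCap y)⁻¹ = 𝔉.sgpCap h * u * (𝔉.sgpCap h)⁻¹)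
    (hdivθ : ∃ (e : 𝔉.AN ≅ 𝔉.AN) (θ : Aut (𝔉.base.obj 𝔉.BN) ≃* Aut (𝔉.base.obj 𝔉.BN)),
      𝔉.pre.div (α.inv ≫ Ψ.functor.map 𝔉.sCap ≫ β.hom) = 𝔉.pre.div (e.hom ≫ 𝔉.sCap) ∧
      𝔉.pre.div (α.inv ≫ Ψ.functor.map 𝔉.sCup ≫ β.hom) = 𝔉.pre.div (e.hom ≫ 𝔉.sCup) ∧
      𝔉.StrvTransport Ψ α e θ ∧ 𝔉.HB.map θ.toMonoidHom = 𝔉.HB)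
    (htor : ∀ (e : 𝔉.AN ≅ 𝔉.AN) (Dc Dp : Aut 𝔉.BN),
      α.inv ≫ Ψ.functor.map 𝔉.sCap ≫ β.hom = e.hom ≫ 𝔉.sCap ≫ Dc.hom →
      α.inv ≫ Ψ.functor.map 𝔉.sCup ≫ β.hom = e.hom ≫ 𝔉.sCup ≫ Dp.hom →
      Dc⁻¹ * Dp ∈ 𝔉.units 𝔉.BN → (Dc⁻¹ * Dp) ^ (2 * 𝔉.l * 𝔉.N) = 1) :
    𝔉.RootTransport Ψ α β := by
  obtain ⟨e, θ, hdc, hdp, hstrv, hYdd⟩ := hdivθ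
  obtain ⟨Dc, Dp, hRT, -⟩ := exists_rootTransportWith_of_model_slim_torsion Ψ α β h𝔉 h hD hslim hnd hN hcap hcup
    hdiff h58 hfac e hdc hdp θ hstrv hYdd (htor e)
  exact hRT.rootTransport

/-- **[EtTh] Theorem 5.10 (ii) and (iii), model case, END-TO-END, torsion clause only** — `Sec5ModelCase.thm510_ii_iii_of_model`
(given `Ψ^bs`) with the binder `hζ` SPLIT: the `(O_K^×)^{1/N}`-half is proved (`Sec5Thm57Constants`, from `H : Facts`
+ `hfac`), only `htor` remains.  [cite: MochizukiEtTh2009, Thm 5.10 (ii)(iii) p.333–335 (PDF pp.107–109); Thm 5.7 p.330 (PDF p.104)] -/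
theorem thm510_ii_iii_of_model_torsion (h𝔉 : 𝔉.pre = PreFrobenioidData.ofModel Φ B DivB)
    (h : ModelFrobenioid.Hypotheses Φ B) (hD : IsOfFSMType D) (H : 𝔉.Facts)
    (hfac : ∀ y ∈ 𝔉.imPiY, ∃ h ∈ 𝔉.HB, ∀ u ∈ 𝔉.units 𝔉.BN,
      𝔉.sgpCap y * u * (𝔉.sgpCap y)⁻¹ = 𝔉.sgpCap h * u * (𝔉.sgpCap h)⁻¹)
    (ΨbiratAut : 𝔉.biratUnits 𝔉.BN ≃* 𝔉.biratUnits 𝔉.BN)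
    (Ψbs : D ⥤ D) [Ψbs.Faithful] (eΨ : Ψ.functor ⋙ 𝔉.base ≅ 𝔉.base ⋙ Ψbs)
    (hsq : ∀ u : 𝔉.units 𝔉.BN, ∀ hu : 𝔉.psiAut Ψ β u ∈ 𝔉.units 𝔉.BN,
      ΨbiratAut (𝔉.unitsToBirat 𝔉.BN u) = 𝔉.unitsToBirat 𝔉.BN ⟨_, hu⟩)
    (hconst : 𝔉.constEmb.range.map ΨbiratAut.toMonoidHom = 𝔉.constEmb.range)
    (e : 𝔉.AN ≅ 𝔉.AN)
    (hcap : 𝔉.pre.div (α.inv ≫ Ψ.functor.map 𝔉.sCap ≫ β.hom) = 𝔉.pre.div (e.hom ≫ 𝔉.sCap))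
    (hcup : 𝔉.pre.div (α.inv ≫ Ψ.functor.map 𝔉.sCup ≫ β.hom) = 𝔉.pre.div (e.hom ≫ 𝔉.sCup))
    (htor : ∀ Dc Dp : Aut 𝔉.BN,
      α.inv ≫ Ψ.functor.map 𝔉.sCap ≫ β.hom = e.hom ≫ 𝔉.sCap ≫ Dc.hom →
      α.inv ≫ Ψ.functor.map 𝔉.sCup ≫ β.hom = e.hom ≫ 𝔉.sCup ≫ Dp.hom →
      Dc⁻¹ * Dp ∈ 𝔉.units 𝔉.BN → (Dc⁻¹ * Dp) ^ (2 * 𝔉.l * 𝔉.N) = 1)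
    (θ : Aut (𝔉.base.obj 𝔉.BN) ≃* Aut (𝔉.base.obj 𝔉.BN))
    (hstrv : ∀ g : Aut (𝔉.base.obj 𝔉.BN),
      α.inv ≫ Ψ.functor.map (𝔉.strv (𝔉.autBaseIsoAB.symm g)).hom ≫ α.hom ≫ e.hom =
        e.hom ≫ (𝔉.strv (𝔉.autBaseIsoAB.symm (θ g))).hom)
    (hY : 𝔉.imPiY.map θ.toMonoidHom = 𝔉.imPiY) (hYdd : 𝔉.HB.map θ.toMonoidHom = 𝔉.HB)
    (ψY : 𝔉.PiX ≃ₜ* 𝔉.PiX)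
    (hbase : ∀ g, 𝔉.autBase 𝔉.BN (𝔉.psiAut Ψ β (𝔉.sgpCap (𝔉.ρ g))) = 𝔉.ρ (ψY g))
    (hψY : 𝔉.PiY.map ψY.toMulEquiv.toMonoidHom = 𝔉.PiY)
    (hψYdd : 𝔉.PiYdd.map ψY.toMulEquiv.toMonoidHom = 𝔉.PiYdd) :
    𝔉.PsiAutPreserves Ψ β ΨbiratAut ∧
      𝔉.MonoThetaEnvCompat H.sectionsFactor 𝔉.outerActionLZ_of H.sgpCapSection H.sgpCupSection
        H.constantsEqNormalizer ∅ Ψ β ψY hbase hψY hψYdd :=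
  thm510_ii_iii_of_torsion Ψ α β (epi_of_model h) (isOfIsotropicType_of_model h𝔉 h.isGroupLike_rat)
    (iiid_of_model h𝔉 h.isGroupLike_rat) (preservesPreSteps_of_model h𝔉 h hD Ψ) H hfac ΨbiratAut Ψbs eΨ hsq
    hconst e hcap hcup htor θ hstrv hY hYdd ψY hbase hψY hψYdd

/-- **[EtTh] Theorem 5.10 (ii)(iii), model case, END-TO-END, no [FrdI] binder, torsion clause only** — as
`Sec5ModelCaseSlim.thm510_ii_iii_of_model_slim` (slim base of FSM-type, `Φ` non-dilating, `C` not of group-like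
type: `Ψ^bs` from layer L1) with `hζ` replaced by `hfac` + `htor`.
[cite: MochizukiEtTh2009, Thm 5.10 (ii)(iii) p.333–335 (PDF pp.107–109); Thm 5.7 p.330 (PDF p.104)] -/
theorem thm510_ii_iii_of_model_slim_torsion (h𝔉 : 𝔉.pre = PreFrobenioidData.ofModel Φ B DivB)
    (h : ModelFrobenioid.Hypotheses Φ B) (hD : IsOfFSMType D) (hslim : IsSlim D) (hnd : IsNonDilatingOn Φ)
    (hN : ∃ A : ModelFrobenioid Φ B DivB, ¬ (PreFrobenioidData.ofModel Φ B DivB).IsGroupLikeObj A)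
    (H : 𝔉.Facts)
    (hfac : ∀ y ∈ 𝔉.imPiY, ∃ h ∈ 𝔉.HB, ∀ u ∈ 𝔉.units 𝔉.BN,
      𝔉.sgpCap y * u * (𝔉.sgpCap y)⁻¹ = 𝔉.sgpCap h * u * (𝔉.sgpCap h)⁻¹)
    (ΨbiratAut : 𝔉.biratUnits 𝔉.BN ≃* 𝔉.biratUnits 𝔉.BN)
    (hsq : ∀ u : 𝔉.units 𝔉.BN, ∀ hu : 𝔉.psiAut Ψ β u ∈ 𝔉.units 𝔉.BN,
      ΨbiratAut (𝔉.unitsToBirat 𝔉.BN u) = 𝔉.unitsToBirat 𝔉.BN ⟨_, hu⟩)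
    (hconst : 𝔉.constEmb.range.map ΨbiratAut.toMonoidHom = 𝔉.constEmb.range)
    (e : 𝔉.AN ≅ 𝔉.AN)
    (hcap : 𝔉.pre.div (α.inv ≫ Ψ.functor.map 𝔉.sCap ≫ β.hom) = 𝔉.pre.div (e.hom ≫ 𝔉.sCap))
    (hcup : 𝔉.pre.div (α.inv ≫ Ψ.functor.map 𝔉.sCup ≫ β.hom) = 𝔉.pre.div (e.hom ≫ 𝔉.sCup))
    (htor : ∀ Dc Dp : Aut 𝔉.BN,
      α.inv ≫ Ψ.functor.map 𝔉.sCap ≫ β.hom = e.hom ≫ 𝔉.sCap ≫ Dc.hom →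
      α.inv ≫ Ψ.functor.map 𝔉.sCup ≫ β.hom = e.hom ≫ 𝔉.sCup ≫ Dp.hom →
      Dc⁻¹ * Dp ∈ 𝔉.units 𝔉.BN → (Dc⁻¹ * Dp) ^ (2 * 𝔉.l * 𝔉.N) = 1)
    (θ : Aut (𝔉.base.obj 𝔉.BN) ≃* Aut (𝔉.base.obj 𝔉.BN))
    (hstrv : ∀ g : Aut (𝔉.base.obj 𝔉.BN),
      α.inv ≫ Ψ.functor.map (𝔉.strv (𝔉.autBaseIsoAB.symm g)).hom ≫ α.hom ≫ e.hom =
        e.hom ≫ (𝔉.strv (𝔉.autBaseIsoAB.symm (θ g))).hom)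
    (hY : 𝔉.imPiY.map θ.toMonoidHom = 𝔉.imPiY) (hYdd : 𝔉.HB.map θ.toMonoidHom = 𝔉.HB)
    (ψY : 𝔉.PiX ≃ₜ* 𝔉.PiX)
    (hbase : ∀ g, 𝔉.autBase 𝔉.BN (𝔉.psiAut Ψ β (𝔉.sgpCap (𝔉.ρ g))) = 𝔉.ρ (ψY g))
    (hψY : 𝔉.PiY.map ψY.toMulEquiv.toMonoidHom = 𝔉.PiY)
    (hψYdd : 𝔉.PiYdd.map ψY.toMulEquiv.toMonoidHom = 𝔉.PiYdd) :
    𝔉.PsiAutPreserves Ψ β ΨbiratAut ∧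
      𝔉.MonoThetaEnvCompat H.sectionsFactor 𝔉.outerActionLZ_of H.sgpCapSection H.sgpCupSection
        H.constantsEqNormalizer ∅ Ψ β ψY hbase hψY hψYdd := by
  obtain ⟨Ψbs, hΨbs, ⟨eΨ⟩⟩ := exists_compatBase_of_model_slim Ψ h𝔉 h hD hslim hnd hN
  haveI := hΨbs
  exact thm510_ii_iii_of_model_torsion Ψ α β h𝔉 h hD H hfac ΨbiratAut Ψbs eΨ hsq hconst e hcap hcup htor θ hstrv
    hY hYdd ψY hbase hψY hψYdd

end Torsion

end ThetaFrobenioid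

end Literature.AnabelianGeometry.EtaleTheta
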